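import Literature.NumberTheory.Sieve.DrappeauDispersion
import Literature.NumberTheory.Sieve.BombieriVinogradovMoebius
import Literature.NumberTheory.Sieve.MontgomeryVaughan1975GaussSums
import HarnessLib

/-!
# Drappeau's small-conductor kernel: reduction to primitive characters and Möbius decoupling

Topic `Literature/NumberTheory/Sieve`; theorems only, everything PROVED.  Companion of
`Literature.NumberTheory.Sieve.DrappeauDispersion` (the kernels `Drappeau2017.uR`, `Drappeau2017.mainKernel` of
S. Drappeau, Proc. London Math. Soc. (3) 114 (2017), §5 (5.1)).  The "main terms" of the dispersion method in
Drappeau's conductor-truncated form are sums `∑_m a_m K_R(m c̄; s)` with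
`K_R(t; s) = φ(s)⁻¹ ∑_{χ mod s, cond χ ≤ R} χ(t)` (`mainKernel`); this file provides the two standard
reductions by which such sums are fed to mean value theorems for primitive characters (Drappeau §6, `𝒮₁⁻`;
Iwaniec–Kowalski §17.1):

* `norm_sum_mul_mainKernel_le` — **reduction to primitive characters**: for a unit `c` of `ZMod s`,
  `‖∑_{m ∈ T} a_m K_R(m c̄; s)‖ ≤ φ(s)⁻¹ ∑_{(f, ψ*) : f ∣ s, ψ* primitive mod f, f ≤ R} ‖∑_{m ∈ T} a_m ψ*_s(m)‖`,
  where `ψ*_s(m) = ψ*(m) 1_{(m, s) = 1}` (`VaughanMoebius.copChar s ψ*`) is the character mod `s` induced by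
  `ψ*` (the index set is the tree's `primIndex s`);
* `sum_mul_copChar_eq_sum_divisors` — **Möbius decoupling of the coprimality**:
  `∑_{m ≤ N} a_m ψ*_s(m) = ∑_{d ∣ s} μ(d) ∑_{t ≤ N/d} a_{dt} ψ*(dt)`;
* `copChar_div_eq_copChar` (`ψ*_{s/f} = ψ*_s` for `f ∣ s`, `ψ* mod f`) and the swap of the `s`-average with
  the character/divisor sums, `sum_weight_primIndex_divisors_le` (`∑_s w(s) ∑_{(f,ψ*) ∈ S_R(s)} ∑_{d ∣ s} G
  ≤ ∑_{(f,ψ*), f ≤ R} ∑_{d ≤ S} (∑_{s : f ∣ s, d ∣ s} w(s)) G` for nonnegative `w, G`).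

Consumer: the double-family Bombieri–Vinogradov bound for `λ` with small-conductor kernels (crux
`TypeI2Dilated`, line `peel-to-drappeau`, stub `stub_mainTerms` of
`Summits/Parity/GeneralizedHardyLittlewood/Theses/LiouvilleShiftedTables.lean`).

## References

* S. Drappeau, Proc. London Math. Soc. (3) 114 (2017) 684–732 = arXiv:1504.05549, §5 (5.1), §6. [Drappeau2017]
* H. Iwaniec, E. Kowalski, *Analytic Number Theory*, AMS 2004, §17.1. [IwaniecKowalski2004]
-/

noncomputable section

open Finset Real Complex

namespace Literature.NumberTheory.Sieve

namespace Drappeau2017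

open VaughanMoebius BVMoebius
open scoped ArithmeticFunction.Moebius Classical

/-! ### Induced characters read modulo `s` -/

/-- For `f ∣ s` (`s ≠ 0`) and `ψ* mod f`: `ψ*_{s/f}(m) = ψ*_s(m)`, i.e. restricting to `(m, s/f) = 1` or to
`(m, s) = 1` gives the same function, because `ψ*(m) = 0` whenever `(m, f) > 1`. [folklore] -/
theorem copChar_div_eq_copChar {s f : ℕ} (hs : s ≠ 0) (hfs : f ∣ s) (χ₁ : DirichletCharacter ℂ f) (m : ℕ) :
    copChar (s / f) χ₁ m = copChar s χ₁ m := by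
  obtain ⟨e, rfl⟩ := hfs
  have hf : f ≠ 0 := left_ne_zero_of_mul hs
  have he : e ≠ 0 := right_ne_zero_of_mul hs
  rw [Nat.mul_div_cancel_left e (Nat.pos_of_ne_zero hf)]
  unfold copChar
  by_cases hm : m.Coprime (f * e)
  · rw [if_pos hm, if_pos (Nat.Coprime.coprime_mul_left_right hm)]
  · rw [if_neg hm]
    by_cases hme : m.Coprime e
    · rw [if_pos hme]
      have hmf : ¬ m.Coprime f := fun h => hm (Nat.Coprime.mul_right h hme)
      exact MulChar.map_nonunit _ (mt (ZMod.isUnit_iff_coprime m f).1 hmf)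
    · rw [if_neg hme]

/-! ### Reduction of the kernel to primitive characters -/

/-- The characters mod `s` of conductor `≤ R` are induced by the pairs `(f, ψ*) ∈ S(s)` with `f ≤ R`.
[folklore] -/
theorem filter_conductor_le_subset_image {s : ℕ} [NeZero s] (R : ℝ) :
    (univ : Finset (DirichletCharacter ℂ s)).filter (fun χ => (χ.conductor : ℝ) ≤ R) ⊆
      ((primIndex s).filter (fun p => ((p.1 : ℕ) : ℝ) ≤ R)).image (induce s) := by
  intro χ hχ
  rw [mem_filter] at hχ
  refine mem_image.2 ⟨⟨χ.conductor, χ.primitiveCharacter⟩, ?_, ?_⟩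
  · exact mem_filter.2 ⟨mem_primIndex.2 ⟨χ.conductor_dvd_level, NeZero.ne s,
      χ.primitiveCharacter_isPrimitive⟩, hχ.2⟩
  · rw [induce, dif_pos χ.conductor_dvd_level]
    exact χ.changeLevel_primitiveCharacter

/-- **Reduction of the small-conductor kernel to primitive characters.**  For `s ≥ 1`, any `c` in
`ZMod s` (a unit in every application), weights `a : ℕ → ℂ` and a finite set `T` of integers,
`‖∑_{m ∈ T} a_m K_R(m c̄; s)‖ ≤ φ(s)⁻¹ ∑_{(f,ψ*) ∈ S(s), f ≤ R} ‖∑_{m ∈ T} a_m ψ*_s(m)‖`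
(expand `K_R`, pull out `χ(c̄)` of modulus one, group the characters by their primitive inducing character).
[cite: Drappeau2017, §5 (5.1)] -/
theorem norm_sum_mul_mainKernel_le {s : ℕ} (hs : 0 < s) (R : ℝ) (c : ZMod s)
    (a : ℕ → ℂ) (T : Finset ℕ) :
    ‖∑ m ∈ T, a m * mainKernel R s ((m : ZMod s) * c⁻¹)‖ ≤
      ((Nat.totient s : ℝ))⁻¹ *
        ∑ p ∈ (primIndex s).filter (fun p => ((p.1 : ℕ) : ℝ) ≤ R), ‖∑ m ∈ T, a m * copChar s p.2 m‖ := by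
  haveI : NeZero s := ⟨hs.ne'⟩
  have hφ : (0 : ℝ) < Nat.totient s := by exact_mod_cast Nat.totient_pos.2 hs
  -- expand the kernel and swap the sums
  have hexp : ∑ m ∈ T, a m * mainKernel R s ((m : ZMod s) * c⁻¹) =
      ((Nat.totient s : ℂ))⁻¹ * ∑ χ : DirichletCharacter ℂ s,
        (if (χ.conductor : ℝ) ≤ R then χ c⁻¹ * ∑ m ∈ T, a m * χ (m : ZMod s) else 0) := by
    unfold mainKernel
    calc ∑ m ∈ T, a m * (((Nat.totient s : ℂ))⁻¹ *
            ∑ χ : DirichletCharacter ℂ s, if (χ.conductor : ℝ) ≤ R then χ ((m : ZMod s) * c⁻¹) else 0)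
        = ((Nat.totient s : ℂ))⁻¹ * ∑ m ∈ T, ∑ χ : DirichletCharacter ℂ s,
            (if (χ.conductor : ℝ) ≤ R then a m * χ ((m : ZMod s) * c⁻¹) else 0) := by
          rw [mul_sum]
          refine sum_congr rfl fun m _ => ?_
          rw [mul_left_comm, mul_sum]
          refine congrArg _ (sum_congr rfl fun χ _ => ?_)
          split_ifs <;> simp
      _ = ((Nat.totient s : ℂ))⁻¹ * ∑ χ : DirichletCharacter ℂ s, ∑ m ∈ T,
            (if (χ.conductor : ℝ) ≤ R then a m * χ ((m : ZMod s) * c⁻¹) else 0) := by rw [sum_comm]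
      _ = _ := by
          refine congrArg _ (sum_congr rfl fun χ _ => ?_)
          split_ifs with h
          · rw [mul_sum]
            refine sum_congr rfl fun m _ => ?_
            rw [map_mul]; ring
          · simp
  rw [hexp, norm_mul, norm_inv, Complex.norm_natCast]
  refine mul_le_mul_of_nonneg_left ?_ (inv_nonneg.2 hφ.le)
  -- bound character by character and pass to the inducing primitive characters
  have hχc : ∀ χ : DirichletCharacter ℂ s, ‖χ c⁻¹‖ ≤ 1 := fun χ => χ.norm_le_one _
  calc ‖∑ χ : DirichletCharacter ℂ s,
          (if (χ.conductor : ℝ) ≤ R then χ c⁻¹ * ∑ m ∈ T, a m * χ (m : ZMod s) else 0)‖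
      ≤ ∑ χ : DirichletCharacter ℂ s,
          ‖(if (χ.conductor : ℝ) ≤ R then χ c⁻¹ * ∑ m ∈ T, a m * χ (m : ZMod s) else 0)‖ :=
        norm_sum_le _ _
    _ ≤ ∑ χ : DirichletCharacter ℂ s,
          (if (χ.conductor : ℝ) ≤ R then ‖∑ m ∈ T, a m * χ (m : ZMod s)‖ else 0) := by
        refine sum_le_sum fun χ _ => ?_
        split_ifs with h
        · rw [norm_mul]
          exact mul_le_of_le_one_left (norm_nonneg _) (hχc χ)
        · simp
    _ = ∑ χ ∈ (univ : Finset (DirichletCharacter ℂ s)).filter (fun χ => (χ.conductor : ℝ) ≤ R),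
          ‖∑ m ∈ T, a m * χ (m : ZMod s)‖ := by rw [sum_filter]
    _ ≤ ∑ χ ∈ ((primIndex s).filter (fun p => ((p.1 : ℕ) : ℝ) ≤ R)).image (induce s),
          ‖∑ m ∈ T, a m * χ (m : ZMod s)‖ :=
        sum_le_sum_of_subset_of_nonneg (filter_conductor_le_subset_image R) fun _ _ _ => norm_nonneg _
    _ ≤ ∑ p ∈ (primIndex s).filter (fun p => ((p.1 : ℕ) : ℝ) ≤ R),
          ‖∑ m ∈ T, a m * (induce s p) (m : ZMod s)‖ :=
        sum_image_le_of_nonneg fun _ _ => norm_nonneg _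
    _ = ∑ p ∈ (primIndex s).filter (fun p => ((p.1 : ℕ) : ℝ) ≤ R), ‖∑ m ∈ T, a m * copChar s p.2 m‖ := by
        refine sum_congr rfl fun p hp => ?_
        obtain ⟨hps, -, -⟩ := mem_primIndex.1 (mem_filter.1 hp).1
        congr 1
        refine sum_congr rfl fun m _ => ?_
        rw [induce, dif_pos hps, changeLevel_apply_natCast hps, copChar_div_eq_copChar hs.ne' hps]

/-! ### Möbius decoupling of the coprimality condition -/

/-- Reindexing the multiples of `d ≥ 1` in `[1, N]`: `∑_{m ≤ N, d ∣ m} F(m) = ∑_{t ≤ N/d} F(dt)`. [folklore] -/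
theorem sum_filter_dvd_Icc_eq {M : Type*} [AddCommMonoid M] {d : ℕ} (hd : 0 < d) (N : ℕ) (F : ℕ → M) :
    ∑ m ∈ (Icc 1 N).filter (d ∣ ·), F m = ∑ t ∈ Icc 1 (N / d), F (d * t) := by
  have himage : (Icc 1 N).filter (d ∣ ·) = (Icc 1 (N / d)).image (fun t => d * t) := by
    ext m
    simp only [mem_filter, mem_Icc, mem_image]
    constructor
    · rintro ⟨⟨hm1, hmN⟩, ⟨t, rfl⟩⟩
      refine ⟨t, ⟨?_, ?_⟩, rfl⟩
      · rcases Nat.eq_zero_or_pos t with h | h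
        · subst h; simp at hm1
        · exact h
      · exact (Nat.le_div_iff_mul_le hd).2 (by rw [mul_comm]; exact hmN)
    · rintro ⟨t, ⟨ht1, htN⟩, rfl⟩
      refine ⟨⟨Nat.mul_pos hd ht1, ?_⟩, dvd_mul_right d t⟩
      have := (Nat.le_div_iff_mul_le hd).1 htN
      rw [mul_comm] at this; exact this
  rw [himage, sum_image fun x _ y _ h => Nat.eq_of_mul_eq_mul_left hd h]

/-- **`∑_{m ≤ N} a_m ψ*_s(m) = ∑_{d ∣ s} μ(d) ∑_{t ≤ N/d} a_{dt} ψ*(dt)`** for `s ≠ 0` (Möbius inversion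
of `1_{(m, s) = 1}` and `m = d t`). [folklore] -/
theorem sum_mul_copChar_eq_sum_divisors {s : ℕ} (hs : s ≠ 0) {f : ℕ} (χ₁ : DirichletCharacter ℂ f)
    (a : ℕ → ℂ) (N : ℕ) :
    ∑ m ∈ Icc 1 N, a m * copChar s χ₁ m =
      ∑ d ∈ s.divisors, (μ d : ℂ) * ∑ t ∈ Icc 1 (N / d), a (d * t) * χ₁ ((d * t : ℕ) : ZMod f) := by
  -- `ψ*_s(m) = (∑_{d ∣ (m, s)} μ(d)) ψ*(m)`
  have h1 : ∀ m : ℕ, copChar s χ₁ m = (∑ d ∈ s.divisors.filter (· ∣ m), (μ d : ℂ)) * χ₁ (m : ZMod f) := by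
    intro m
    rw [copChar_eq, show (copInd s m : ℂ) = (if m.Coprime s then (1 : ℂ) else 0) by
      unfold copInd; split_ifs <;> simp, MontgomeryVaughan1975.coprime_indicator_eq_sum_moebius m s]
    congr 1
    refine sum_congr ?_ fun _ _ => rfl
    ext d
    simp only [Nat.mem_divisors, mem_filter, Nat.dvd_gcd_iff, ne_eq, Nat.gcd_eq_zero_iff, not_and]
    constructor
    · rintro ⟨⟨hdm, hds⟩, -⟩; exact ⟨⟨hds, hs⟩, hdm⟩
    · rintro ⟨⟨hds, -⟩, hdm⟩; exact ⟨⟨hdm, hds⟩, fun _ => hs⟩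
  simp_rw [h1]
  -- swap the `m`- and `d`-sums
  calc ∑ m ∈ Icc 1 N, a m * ((∑ d ∈ s.divisors.filter (· ∣ m), (μ d : ℂ)) * χ₁ (m : ZMod f))
      = ∑ m ∈ Icc 1 N, ∑ d ∈ s.divisors, (if d ∣ m then (μ d : ℂ) * (a m * χ₁ (m : ZMod f)) else 0) := by
        refine sum_congr rfl fun m _ => ?_
        rw [sum_filter, mul_left_comm, sum_mul]
        refine sum_congr rfl fun d _ => ?_
        split_ifs <;> ring
    _ = ∑ d ∈ s.divisors, ∑ m ∈ Icc 1 N, (if d ∣ m then (μ d : ℂ) * (a m * χ₁ (m : ZMod f)) else 0) :=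
        sum_comm
    _ = ∑ d ∈ s.divisors, (μ d : ℂ) * ∑ m ∈ (Icc 1 N).filter (d ∣ ·), a m * χ₁ (m : ZMod f) := by
        refine sum_congr rfl fun d _ => ?_
        rw [sum_filter, mul_sum]
        refine sum_congr rfl fun m _ => ?_
        split_ifs <;> simp
    _ = _ := by
        refine sum_congr rfl fun d hd => ?_
        have hd0 : 0 < d := Nat.pos_of_mem_divisors hd
        congr 1
        exact sum_filter_dvd_Icc_eq hd0 N fun m => a m * χ₁ (m : ZMod f)

/-! ### Swapping the average over the smooth modulus with the character and divisor sums -/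

/-- The index set of pairs `(f, ψ*)`, `1 ≤ f ≤ F`, `ψ*` primitive mod `f` (all primitive characters of
conductor at most `F`). [folklore] -/
def primIndexLe (F : ℕ) : Finset (Σ f : ℕ, DirichletCharacter ℂ f) :=
  (Icc 1 F).sigma fun f => (univ : Finset (DirichletCharacter ℂ f)).filter DirichletCharacter.IsPrimitive

/-- Membership in `primIndexLe F`. [folklore] -/
theorem mem_primIndexLe {F : ℕ} {p : Σ f : ℕ, DirichletCharacter ℂ f} :
    p ∈ primIndexLe F ↔ 1 ≤ p.1 ∧ p.1 ≤ F ∧ p.2.IsPrimitive := by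
  simp [primIndexLe, and_assoc]

/-- For `s ≠ 0`: the pairs `(f, ψ*) ∈ S(s)` with `f ≤ R` lie in `primIndexLe ⌊R⌋`. [folklore] -/
theorem filter_primIndex_subset_primIndexLe {s : ℕ} (R : ℝ) :
    (primIndex s).filter (fun p => ((p.1 : ℕ) : ℝ) ≤ R) ⊆ primIndexLe ⌊R⌋₊ := by
  intro p hp
  rw [mem_filter] at hp
  obtain ⟨hps, hs, hprim⟩ := mem_primIndex.1 hp.1
  have hp1 : 1 ≤ p.1 := Nat.pos_of_ne_zero fun h => hs (Nat.eq_zero_of_zero_dvd (h ▸ hps))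
  exact mem_primIndexLe.2 ⟨hp1, Nat.le_floor hp.2, hprim⟩

/-- **Swapping the `s`-average with the character and divisor sums.**  For nonnegative weights `w(s)`
(`s` in a finite set `𝒮` of positive integers `≤ S`) and nonnegative `G(p, d)`:
`∑_{s ∈ 𝒮} w(s) ∑_{p ∈ S(s), p.1 ≤ R} ∑_{d ∣ s} G(p, d) ≤ ∑_{p ∈ primIndexLe ⌊R⌋} ∑_{d ≤ S} (∑_{s ∈ 𝒮, p.1 ∣ s, d ∣ s} w(s)) G(p, d)`.
[folklore] -/
theorem sum_weight_primIndex_divisors_le {𝒮 : Finset ℕ} {S : ℕ} (h𝒮 : 𝒮 ⊆ Icc 1 S) (R : ℝ)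
    {w : ℕ → ℝ} (hw : ∀ s ∈ 𝒮, 0 ≤ w s)
    {G : (Σ f : ℕ, DirichletCharacter ℂ f) → ℕ → ℝ} (hG : ∀ p d, 0 ≤ G p d) :
    ∑ s ∈ 𝒮, w s * ∑ p ∈ (primIndex s).filter (fun p => ((p.1 : ℕ) : ℝ) ≤ R), ∑ d ∈ s.divisors, G p d ≤
      ∑ p ∈ primIndexLe ⌊R⌋₊, ∑ d ∈ Icc 1 S,
        (∑ s ∈ 𝒮.filter (fun s => p.1 ∣ s ∧ d ∣ s), w s) * G p d := by
  -- enlarge the inner index sets to the fixed ones, with indicators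
  have hstep : ∀ s ∈ 𝒮, w s * ∑ p ∈ (primIndex s).filter (fun p => ((p.1 : ℕ) : ℝ) ≤ R),
      ∑ d ∈ s.divisors, G p d ≤
      ∑ p ∈ primIndexLe ⌊R⌋₊, ∑ d ∈ Icc 1 S, (if p.1 ∣ s ∧ d ∣ s then w s else 0) * G p d := by
    intro s hs
    have hs1 : 1 ≤ s := (mem_Icc.1 (h𝒮 hs)).1
    have hsS : s ≤ S := (mem_Icc.1 (h𝒮 hs)).2
    have hs0 : s ≠ 0 := by omega
    calc w s * ∑ p ∈ (primIndex s).filter (fun p => ((p.1 : ℕ) : ℝ) ≤ R), ∑ d ∈ s.divisors, G p d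
        = ∑ p ∈ (primIndex s).filter (fun p => ((p.1 : ℕ) : ℝ) ≤ R), ∑ d ∈ s.divisors, w s * G p d := by
          rw [mul_sum]; refine sum_congr rfl fun p _ => ?_; rw [mul_sum]
      _ = ∑ p ∈ (primIndex s).filter (fun p => ((p.1 : ℕ) : ℝ) ≤ R), ∑ d ∈ s.divisors,
            (if p.1 ∣ s then w s else 0) * G p d := by
          refine sum_congr rfl fun p hp => sum_congr rfl fun d _ => ?_
          obtain ⟨hps, -, -⟩ := mem_primIndex.1 (mem_filter.1 hp).1
          rw [if_pos hps]
      _ ≤ ∑ p ∈ primIndexLe ⌊R⌋₊, ∑ d ∈ s.divisors, (if p.1 ∣ s then w s else 0) * G p d := by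
          refine sum_le_sum_of_subset_of_nonneg (filter_primIndex_subset_primIndexLe R) ?_
          intro p _ _
          exact sum_nonneg fun d _ => mul_nonneg (by split_ifs <;> [exact hw s hs; exact le_rfl]) (hG p d)
      _ ≤ ∑ p ∈ primIndexLe ⌊R⌋₊, ∑ d ∈ Icc 1 S, (if p.1 ∣ s ∧ d ∣ s then w s else 0) * G p d := by
          refine sum_le_sum fun p _ => ?_
          have hsub : s.divisors ⊆ Icc 1 S := fun d hd =>
            mem_Icc.2 ⟨Nat.pos_of_mem_divisors hd, (Nat.divisor_le hd).trans hsS⟩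
          refine (sum_le_sum_of_subset_of_nonneg hsub ?_).trans' ?_
          · intro d _ _
            exact mul_nonneg (by split_ifs <;> [exact hw s hs; exact le_rfl]) (hG p d)
          · refine sum_le_sum fun d hd => ?_
            have hds : d ∣ s := Nat.dvd_of_mem_divisors hd
            by_cases hps : p.1 ∣ s
            · rw [if_pos hps, if_pos ⟨hps, hds⟩]
            · rw [if_neg hps, if_neg (fun h => hps h.1)]
  refine (sum_le_sum hstep).trans ?_
  rw [sum_comm]
  refine sum_le_sum fun p _ => ?_
  rw [sum_comm]
  refine sum_le_sum fun d _ => ?_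
  rw [← sum_mul, sum_filter]

end Drappeau2017

end Literature.NumberTheory.Sieve

end
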